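import Literature.AlgebraicGeometry.Motives.HodgeThetaAnnihilatorLieAlgebra
import Literature.AlgebraicGeometry.Motives.HodgeStructureProofs
import HarnessLib

/-!
# Rational tensors on `V₁ ⊕ V₂` killed by `Θ` are killed by `𝔰𝔭_{E}(V₁, ψ₁)_ℂ ⊕ 0` when `V₁` has real `𝔰𝔩₂`-blocks and the commutant on `V₂` is abelian (Lombardo 2016, Lemma 3.4 / Moonen–Zarhin 1999 (3.1): `Hg(A × B) = Hg(A) × Hg(B)` for `B` of CM type — the Lie step, derived-algebra form)

Family `hodge`, layer `Literature/AlgebraicGeometry/Motives` (abstract polarizable `ℚ`-Hodge structures;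
no geometry). Research context: cell `pub-hodge-ring2` (HONEST FRAMING: research route conditional on
HC_CM; not a corollary; Q11.4-sentence-2 already refuted in dim ≥ 3), Literature lane, real-multiplication
programme R4 («RM × CM»). This file is UNCONDITIONAL and no step towards a summit statement.

THE PRINTED RESULT. D. Lombardo, *On the ℓ-adic Galois representations attached to nonsimple abelian
varieties*, Ann. Inst. Fourier **66** (2016), Lemma 3.4 (p. 1229; Lemma 35 of arXiv:1402.1478): «Suppose `B`
is of CM type and `A_K̄` has no simple factor of type IV. Then we have `H(A × B) ≅ H(A) × H(B)`», proved
there from: `H = H(A × B) ⊆ H(A) × H(B)` projects onto both factors, `H(A)` is semisimple, `H(B)` is a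
torus, so `H^{der}` projects onto `H(A)^{der} = H(A)` inside `H(A) × 1` — «an inclusion of connected
reductive groups with surjective projections and full rank is an isomorphism» (Lemma 3.2 ibid.). With
Moonen–Zarhin, *Hodge classes on abelian varieties of low dimension*, Math. Ann. **315** (1999) §3 (3.1)
(«`Hg(X₁ × X₂) = Hg(X₁) × Hg(X₂)` … holds if and only if … the Hodge ring `B(X₁^m × X₂^n)` is generated
by the elements coming from `B(X₁^m)` and `B(X₂^n)`») this is the input `Lombardo2016_hodgeClassesProductSpan`
of the tree's product lane (`HodgeTheory/HodgeGroupProductCMFactor`).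

THIS FILE: THE LIE STEP OF THAT PROOF, WITHOUT ALGEBRAIC GROUPS, in the tree's word model
(`HodgeThetaAnnihilatorLieAlgebra`, THEOREM L). SETTING: a `ℚ`-space `U` presented as `V₁ ⊕ V₂` by
linear maps `ι₁ : V₁ → U`, `π₁ : U → V₁`, `ι₂`, `π₂` (`π₁ι₁ = 1`, `π₂ι₂ = 1`, `π₁ι₂ = 0`, `π₂ι₁ = 0`,
`ι₁π₁ + ι₂π₂ = 1`); Hodge structures `H_U`, `H₁`, `H₂` of the same odd weight with `ι₁`, `ι₂` mapping
Hodge pieces into Hodge pieces (so `Θ_U ι_i = ι_i Θ_i`); on `V₁` the data of the `Θ`-subalgebra theorem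
(`HodgeThetaSubalgebraRealPlacesSl2`: polarization `ψ₁` with `End_Hdg(V₁)` self-adjoint, real characters
`σ` of `End_Hdg(V₁)` with an internal decomposition of `V₁ ⊗ ℂ` into two-dimensional eigenblocks — an
abelian variety with real `𝔰𝔩₂`-block data); on `V₂` a family `aF₂` of Hodge endomorphisms WHOSE COMMUTANT
IN `End_ℚ(V₂)` IS COMMUTATIVE (a CM abelian variety: `H¹` is free of rank one over the CM algebra). MAIN
RESULT (`wordDerAt_assemble_eq_zero_of_semisimple_times_abelian`): a RATIONAL coefficient tensor `q` on
`U` (letters: slots × a `ℚ`-basis of `U`) killed slice by slice by the matrix of the Hodge operator `Θ_U`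
is killed by the matrix of `ι₁ ∘ Z ∘ π₁` for EVERY block-diagonal operator `Z` of `V₁ ⊗ ℂ` with trace-free
blocks, i.e. by all of `⊕_i 𝔰𝔩(T_{σ_i}) ⊕ 0`.

PROOF (Deligne LNM 900 I §3 + Lombardo's derived-group argument in Lie form). Let `𝔞 ⊆ End_ℚ(U)` be the
rational annihilator algebra of `q` (`annLie`) cut out by: killing `q`, commuting with the Hodge
endomorphisms `ι₁π₁`, `ι₂π₂`, `ι₁ a π₁` (`a ∈ End_Hdg(V₁)`), `ι₂ f π₂` (`f ∈ aF₂`), and skewness for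
`φ_U = ψ₁(π₁ ·, π₁ ·)`. It is bracket-closed and `Θ_U ∈ 𝔞_ℂ` by descent (§2–§3). Every `X ∈ 𝔞` is block
diagonal, `X = ι₁ c₁(X) π₁ + ι₂ c₂(X) π₂`, with `c₁(X) = π₁Xι₁ ∈ 𝔰𝔭_E(V₁, ψ₁)` and `c₂(X)` in the
commutant of `aF₂`; hence (§4, the GOURSAT STEP) `[X, X'] = ι₁ [c₁X, c₁X'] π₁` — the `V₂`-components commute.
The corner algebra `𝔤 = c₁(𝔞) ⊆ 𝔰𝔭_E(V₁, ψ₁)` is bracket-closed with `Θ₁ = c₁(Θ_U) ∈ 𝔤_ℂ`, so by the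
`Θ`-subalgebra theorem `𝔤_ℂ ⊇ ⊕_i 𝔰𝔩(T_{σ_i})` (§5); therefore `ι₁ [Y, Y'] π₁ ∈ 𝔞_ℂ` for all
`Y, Y' ∈ ⊕_i 𝔰𝔩(T_{σ_i})`, and `𝔰𝔩₂ = [𝔰𝔩₂, 𝔰𝔩₂]` (§6: `N = [h, ½ n₀₁ e] + [½ n₁₀ f, h] + [n₀₀ e, f]`
for trace-free `N`) gives `ι₁ Z π₁ ∈ 𝔞_ℂ` for every block-diagonal `Z` with trace-free blocks; `𝔞_ℂ` kills `q`.

CONTENTS (all proved; no definition, no named fact, D-0026):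
* §1 slot calculus (`proj_incl_baseChange`, …); §2 `theta_incl_eq`, `proj_theta_eq` (`Θ_U ι = ι Θ`,
  `π Θ_U = Θ π` from piece compatibility and `V_ℂ = ⊕ V^{p,q}`);
* §3 `baseChange_compl₁₂_apply` (complexification of `ψ(π ·, π ·)`);
* §4 `bracket_eq_incl_corner_bracket_proj` (Goursat step), `incl_bracket_proj_mem_spanC` (complex form);
* §5–§6 `assemble_eq_sum_brackets` (`𝔰𝔩₂` is perfect, blockwise), MAIN THEOREM
  `wordDerAt_assemble_eq_zero_of_semisimple_times_abelian`.

## References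

* [Lombardo2016] D. Lombardo, Ann. Inst. Fourier 66 (2016), Lemma 3.2, Lemma 3.4 (p. 1229) = arXiv:1402.1478
  Lemmas 32, 35 (held: `paper:arxiv-1402.1478` p. 8). [cite: Lombardo2016, Lemma 3.4 (p. 1229)]
* [MoonenZarhin1999LowDim] B. Moonen, Yu. Zarhin, Math. Ann. 315 (1999), §3 (3.1)–(3.2)
  (held: `paper:arxiv-math_9901113` p. 6). [cite: MoonenZarhin1999LowDim, §3 (3.1)]
* [Deligne1982HodgeCycles] P. Deligne, LNM 900 (1982), I §3 (proof of Prop. 3.4). [cite: Deligne1982HodgeCycles, I §3 Prop. 3.4]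
* [Hazama1983] F. Hazama, Tôhoku Math. J. 35 (1983), §3 pp. 305–306. [cite: Hazama1983, §3 (pp. 305–306)]
* [GoodmanWallachGTM255] R. Goodman, N. R. Wallach, GTM 255 (2009), §2.5.3 (`𝔰𝔩₂` triples), §4.1.1.
  [cite: GoodmanWallachGTM255, §4.1.1]
-/

noncomputable section

open scoped TensorProduct
open CategoryTheory Module

namespace Literature.AlgebraicGeometry.Motives

namespace HodgeStructure

open RealPlaces Literature.RepresentationTheory.GeneralLinear

/-! ### §1 Slot calculus: `U = ι₁ V₁ ⊕ ι₂ V₂` and its complexification -/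

section Slots

universe u

variable {U V₁ V₂ : Type u} [AddCommGroup U] [Module ℚ U] [AddCommGroup V₁] [Module ℚ V₁]
  [AddCommGroup V₂] [Module ℚ V₂]

/-- `π_ℂ ι_ℂ = 1` from `π ι = 1`. [cite: Lombardo2016, Lemma 3.4 (p. 1229)] -/
theorem proj_incl_baseChange {ι : V₁ →ₗ[ℚ] U} {π : U →ₗ[ℚ] V₁} (h : π ∘ₗ ι = LinearMap.id)
    (x : ℂ ⊗[ℚ] V₁) : π.baseChange ℂ (ι.baseChange ℂ x) = x := by
  rw [← LinearMap.comp_apply, ← LinearMap.baseChange_comp, h, LinearMap.baseChange_id, LinearMap.id_apply]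

/-- `π_ℂ ι'_ℂ = 0` from `π ι' = 0`. [cite: Lombardo2016, Lemma 3.4 (p. 1229)] -/
theorem proj_incl_baseChange_eq_zero {ι : V₂ →ₗ[ℚ] U} {π : U →ₗ[ℚ] V₁} (h : π ∘ₗ ι = 0)
    (x : ℂ ⊗[ℚ] V₂) : π.baseChange ℂ (ι.baseChange ℂ x) = 0 := by
  rw [← LinearMap.comp_apply, ← LinearMap.baseChange_comp, h, LinearMap.baseChange_zero, LinearMap.zero_apply]

/-- `ι₁,ℂ π₁,ℂ + ι₂,ℂ π₂,ℂ = 1` from `ι₁π₁ + ι₂π₂ = 1`. [cite: Lombardo2016, Lemma 3.4 (p. 1229)] -/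
theorem incl_proj_add_baseChange {ι₁ : V₁ →ₗ[ℚ] U} {π₁ : U →ₗ[ℚ] V₁} {ι₂ : V₂ →ₗ[ℚ] U} {π₂ : U →ₗ[ℚ] V₂}
    (h : ι₁ ∘ₗ π₁ + ι₂ ∘ₗ π₂ = LinearMap.id) (y : ℂ ⊗[ℚ] U) :
    ι₁.baseChange ℂ (π₁.baseChange ℂ y) + ι₂.baseChange ℂ (π₂.baseChange ℂ y) = y := by
  have h' := congrArg (fun f : U →ₗ[ℚ] U => f.baseChange ℂ y) h
  simp only [LinearMap.baseChange_add, LinearMap.add_apply, LinearMap.baseChange_comp, LinearMap.comp_apply,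
    LinearMap.baseChange_id, LinearMap.id_apply] at h'
  exact h'

/-- `ι₁ π₁ y + ι₂ π₂ y = y`. [cite: Lombardo2016, Lemma 3.4 (p. 1229)] -/
theorem incl_proj_add_apply {ι₁ : V₁ →ₗ[ℚ] U} {π₁ : U →ₗ[ℚ] V₁} {ι₂ : V₂ →ₗ[ℚ] U} {π₂ : U →ₗ[ℚ] V₂}
    (h : ι₁ ∘ₗ π₁ + ι₂ ∘ₗ π₂ = LinearMap.id) (y : U) : ι₁ (π₁ y) + ι₂ (π₂ y) = y := by
  have h' := congrArg (fun f : U →ₗ[ℚ] U => f y) h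
  simpa using h'

/-- **Block-diagonal operators.** If `X` commutes with the projector `ι π` then `X ι = ι (π X ι)` (given
`π ι = 1`). [cite: Lombardo2016, Lemma 3.4 (p. 1229)] -/
theorem apply_incl_eq_of_commute_projector {ι : V₁ →ₗ[ℚ] U} {π : U →ₗ[ℚ] V₁} (h : π ∘ₗ ι = LinearMap.id)
    {X : Module.End ℚ U} (hX : X * (ι ∘ₗ π) = (ι ∘ₗ π) * X) (v : V₁) :
    X (ι v) = ι (π (X (ι v))) := by
  have h1 : ι (π (ι v)) = ι v := by rw [← LinearMap.comp_apply (f := π), h, LinearMap.id_apply]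
  have h2 := congrArg (fun f : Module.End ℚ U => f (ι v)) hX
  simp only [Module.End.mul_apply, LinearMap.comp_apply] at h2
  rw [h1] at h2
  exact h2

end Slots

/-! ### §2 `Θ_U ι = ι Θ` and `π Θ_U = Θ π` from piece compatibility -/

section Theta

universe u

variable {U V₁ V₂ : Type u} [AddCommGroup U] [Module ℚ U] [AddCommGroup V₁] [Module ℚ V₁]
  [AddCommGroup V₂] [Module ℚ V₂] {n : ℤ}

/-- **`Θ_U ∘ ι_ℂ = ι_ℂ ∘ Θ`** when `ι_ℂ` maps `V^{p,n-p}` into `U^{p,n-p}` (both sides are `(2p-n) ι x` on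
`V^{p,n-p}`, and `V_ℂ = ⊕_p V^{p,n-p}`, `iSup_piece_eq_top_holds`). [cite: Deligne1982HodgeCycles, I §3 Prop. 3.4] -/
theorem theta_incl_eq (HU : HodgeStructure U n) (H : HodgeStructure V₁ n) {ι : V₁ →ₗ[ℚ] U}
    (hιF : ∀ p, ∀ x ∈ H.piece p (n - p), ι.baseChange ℂ x ∈ HU.piece p (n - p))
    {ΘU : Module.End ℂ (ℂ ⊗[ℚ] U)} (hΘU : ∀ p, ∀ x ∈ HU.piece p (n - p), ΘU x = ((2 * p - n : ℤ) : ℂ) • x)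
    {Θ : Module.End ℂ (ℂ ⊗[ℚ] V₁)} (hΘ : ∀ p, ∀ x ∈ H.piece p (n - p), Θ x = ((2 * p - n : ℤ) : ℂ) • x)
    (x : ℂ ⊗[ℚ] V₁) : ΘU (ι.baseChange ℂ x) = ι.baseChange ℂ (Θ x) := by
  have hx : x ∈ ⨆ p : ℤ, H.piece p (n - p) := by rw [iSup_piece_eq_top_holds H]; exact Submodule.mem_top
  induction hx using Submodule.iSup_induction' with
  | mem p x hx => rw [hΘU p _ (hιF p x hx), hΘ p x hx, map_smul]
  | zero => simp
  | add x y _ _ hx hy => rw [map_add, map_add, hx, hy, map_add, map_add]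

/-- **`π₁,ℂ ∘ Θ_U = Θ₁ ∘ π₁,ℂ`** for a presentation `U = ι₁V₁ ⊕ ι₂V₂` compatible with the Hodge pieces.
[cite: Deligne1982HodgeCycles, I §3 Prop. 3.4] [cite: Lombardo2016, Lemma 3.4 (p. 1229)] -/
theorem proj_theta_eq (HU : HodgeStructure U n) (H₁ : HodgeStructure V₁ n) (H₂ : HodgeStructure V₂ n)
    {ι₁ : V₁ →ₗ[ℚ] U} {π₁ : U →ₗ[ℚ] V₁} {ι₂ : V₂ →ₗ[ℚ] U} {π₂ : U →ₗ[ℚ] V₂}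
    (hπι₁ : π₁ ∘ₗ ι₁ = LinearMap.id) (hπ₁ι₂ : π₁ ∘ₗ ι₂ = 0) (hsum : ι₁ ∘ₗ π₁ + ι₂ ∘ₗ π₂ = LinearMap.id)
    (hι₁F : ∀ p, ∀ x ∈ H₁.piece p (n - p), ι₁.baseChange ℂ x ∈ HU.piece p (n - p))
    (hι₂F : ∀ p, ∀ x ∈ H₂.piece p (n - p), ι₂.baseChange ℂ x ∈ HU.piece p (n - p))
    {ΘU : Module.End ℂ (ℂ ⊗[ℚ] U)} (hΘU : ∀ p, ∀ x ∈ HU.piece p (n - p), ΘU x = ((2 * p - n : ℤ) : ℂ) • x)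
    {Θ₁ : Module.End ℂ (ℂ ⊗[ℚ] V₁)} (hΘ₁ : ∀ p, ∀ x ∈ H₁.piece p (n - p), Θ₁ x = ((2 * p - n : ℤ) : ℂ) • x)
    {Θ₂ : Module.End ℂ (ℂ ⊗[ℚ] V₂)} (hΘ₂ : ∀ p, ∀ x ∈ H₂.piece p (n - p), Θ₂ x = ((2 * p - n : ℤ) : ℂ) • x)
    (y : ℂ ⊗[ℚ] U) : π₁.baseChange ℂ (ΘU y) = Θ₁ (π₁.baseChange ℂ y) := by
  conv_lhs => rw [← incl_proj_add_baseChange hsum y]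
  rw [map_add, theta_incl_eq HU H₁ hι₁F hΘU hΘ₁, theta_incl_eq HU H₂ hι₂F hΘU hΘ₂, map_add,
    proj_incl_baseChange hπι₁, proj_incl_baseChange_eq_zero hπ₁ι₂, add_zero]

end Theta

/-! ### §3 Complexification of the pulled-back form `ψ(π ·, π ·)` -/

section Form

universe u

variable {U V₁ : Type u} [AddCommGroup U] [Module ℚ U] [AddCommGroup V₁] [Module ℚ V₁]

/-- `(ψ ∘ (π × π))_ℂ (x, y) = ψ_ℂ (π_ℂ x, π_ℂ y)` (extension of scalars of a pulled-back bilinear form; used for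
the restriction «`H ⊆ H(A) × H(B)`» of the polarization to the first factor). [cite: Deligne1982HodgeCycles, I §3 (proof of Prop. 3.4)] -/
theorem baseChange_compl₁₂_apply (ψ : LinearMap.BilinForm ℚ V₁) (π : U →ₗ[ℚ] V₁) (x y : ℂ ⊗[ℚ] U) :
    LinearMap.BilinForm.baseChange ℂ (ψ.compl₁₂ π π) x y =
      ψ.baseChange ℂ (π.baseChange ℂ x) (π.baseChange ℂ y) := by
  induction x using TensorProduct.induction_on with
  | zero => simp
  | tmul c v =>
    induction y using TensorProduct.induction_on with
    | zero => simp
    | tmul d w =>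
      simp only [LinearMap.BilinForm.baseChange_tmul, LinearMap.baseChange_tmul]
      rfl
    | add y y' hy hy' => rw [map_add, map_add, map_add, hy, hy']
  | add x x' hx hx' =>
    rw [map_add, LinearMap.add_apply, map_add, map_add, LinearMap.add_apply, hx, hx']

end Form

/-! ### §4 The Goursat step: brackets of block-diagonal operators with commuting `V₂`-corners -/

section Goursat

universe u

variable {U V₁ V₂ : Type u} [AddCommGroup U] [Module ℚ U] [AddCommGroup V₁] [Module ℚ V₁]
  [AddCommGroup V₂] [Module ℚ V₂]

/-- **Composition of block-diagonal operators.** If `Z`, `Z'` commute with the projectors `ι₁π₁`, `ι₂π₂` of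
a presentation `U = ι₁V₁ ⊕ ι₂V₂`, then `Z (Z' y) = ι₁ (c₁Z (c₁Z' (π₁ y))) + ι₂ (c₂Z (c₂Z' (π₂ y)))` with the
corners `c₁Z = π₁ Z ι₁`, `c₂Z = π₂ Z ι₂` («`H ⊆ H(A) × H(B)`»). [cite: Lombardo2016, Lemma 3.4 (p. 1229)] -/
theorem mul_apply_eq_of_commute_projectors {ι₁ : V₁ →ₗ[ℚ] U} {π₁ : U →ₗ[ℚ] V₁} {ι₂ : V₂ →ₗ[ℚ] U}
    {π₂ : U →ₗ[ℚ] V₂} (hπι₁ : π₁ ∘ₗ ι₁ = LinearMap.id) (hπι₂ : π₂ ∘ₗ ι₂ = LinearMap.id)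
    (hsum : ι₁ ∘ₗ π₁ + ι₂ ∘ₗ π₂ = LinearMap.id) {Z Z' : Module.End ℚ U}
    (hZ₁ : Z * (ι₁ ∘ₗ π₁) = (ι₁ ∘ₗ π₁) * Z) (hZ₂ : Z * (ι₂ ∘ₗ π₂) = (ι₂ ∘ₗ π₂) * Z)
    (hZ'₁ : Z' * (ι₁ ∘ₗ π₁) = (ι₁ ∘ₗ π₁) * Z') (hZ'₂ : Z' * (ι₂ ∘ₗ π₂) = (ι₂ ∘ₗ π₂) * Z') (y : U) :
    Z (Z' y) = ι₁ (π₁ (Z (ι₁ (π₁ (Z' (ι₁ (π₁ y))))))) + ι₂ (π₂ (Z (ι₂ (π₂ (Z' (ι₂ (π₂ y))))))) := by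
  have h1 : ∀ v, π₁ (ι₁ v) = v := fun v => by
    rw [← LinearMap.comp_apply (f := π₁), hπι₁, LinearMap.id_apply]
  have h2 : ∀ w, π₂ (ι₂ w) = w := fun w => by
    rw [← LinearMap.comp_apply (f := π₂), hπι₂, LinearMap.id_apply]
  conv_lhs => rw [← incl_proj_add_apply hsum y]
  rw [map_add, map_add, apply_incl_eq_of_commute_projector hπι₁ hZ'₁, apply_incl_eq_of_commute_projector hπι₂ hZ'₂,
    apply_incl_eq_of_commute_projector hπι₁ hZ₁, apply_incl_eq_of_commute_projector hπι₂ hZ₂]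
  simp only [h1, h2]

/-- **The Goursat step (Lombardo's derived-group argument, Lie form).** For block-diagonal `X`, `X'` whose
`V₂`-corners commute, the bracket lives on `V₁` alone: `[X, X'] = ι₁ [c₁X, c₁X'] π₁` («`H^{der}` lies in
`H(A) × 1` since `H(B)` is a torus»). [cite: Lombardo2016, Lemma 3.4 (p. 1229)] [cite: MoonenZarhin1999LowDim, §3 (3.1)] -/
theorem bracket_eq_incl_corner_bracket_proj {ι₁ : V₁ →ₗ[ℚ] U} {π₁ : U →ₗ[ℚ] V₁} {ι₂ : V₂ →ₗ[ℚ] U}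
    {π₂ : U →ₗ[ℚ] V₂} (hπι₁ : π₁ ∘ₗ ι₁ = LinearMap.id) (hπι₂ : π₂ ∘ₗ ι₂ = LinearMap.id)
    (hsum : ι₁ ∘ₗ π₁ + ι₂ ∘ₗ π₂ = LinearMap.id) {X X' : Module.End ℚ U}
    (hX₁ : X * (ι₁ ∘ₗ π₁) = (ι₁ ∘ₗ π₁) * X) (hX₂ : X * (ι₂ ∘ₗ π₂) = (ι₂ ∘ₗ π₂) * X)
    (hX'₁ : X' * (ι₁ ∘ₗ π₁) = (ι₁ ∘ₗ π₁) * X') (hX'₂ : X' * (ι₂ ∘ₗ π₂) = (ι₂ ∘ₗ π₂) * X')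
    (hcomm₂ : (π₂ ∘ₗ X ∘ₗ ι₂) * (π₂ ∘ₗ X' ∘ₗ ι₂) = (π₂ ∘ₗ X' ∘ₗ ι₂) * (π₂ ∘ₗ X ∘ₗ ι₂)) :
    X * X' - X' * X =
      ι₁ ∘ₗ ((π₁ ∘ₗ X ∘ₗ ι₁) * (π₁ ∘ₗ X' ∘ₗ ι₁) - (π₁ ∘ₗ X' ∘ₗ ι₁) * (π₁ ∘ₗ X ∘ₗ ι₁)) ∘ₗ π₁ := by
  apply LinearMap.ext
  intro y
  have h2 : ∀ w : V₂, π₂ (X (ι₂ (π₂ (X' (ι₂ w))))) = π₂ (X' (ι₂ (π₂ (X (ι₂ w))))) := fun w => by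
    have h := congrArg (fun f : Module.End ℚ V₂ => f w) hcomm₂
    simpa only [Module.End.mul_apply, LinearMap.comp_apply] using h
  rw [LinearMap.sub_apply, Module.End.mul_apply, Module.End.mul_apply,
    mul_apply_eq_of_commute_projectors hπι₁ hπι₂ hsum hX₁ hX₂ hX'₁ hX'₂,
    mul_apply_eq_of_commute_projectors hπι₁ hπι₂ hsum hX'₁ hX'₂ hX₁ hX₂, h2 (π₂ y)]
  simp only [LinearMap.comp_apply, LinearMap.sub_apply, Module.End.mul_apply, map_sub]
  abel

/-- **Complex form of the Goursat step.** If `ι₁ [c₁X, c₁X'] π₁ ∈ 𝔞` for all `X, X'` in a rational subspace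
`𝔞 ⊆ End_ℚ(U)`, then `ι₁,ℂ [Y, Y'] π₁,ℂ ∈ 𝔞_ℂ` for all `Y, Y'` in the complex span of the corners
`(π₁ X ι₁)_ℂ`, `X ∈ 𝔞` (bilinearity). [cite: Lombardo2016, Lemma 3.4 (p. 1229)] [cite: Deligne1982HodgeCycles, I §3 (proof of Prop. 3.4)] -/
theorem incl_bracket_proj_mem_spanC {ι₁ : V₁ →ₗ[ℚ] U} {π₁ : U →ₗ[ℚ] V₁} (𝔞 : Submodule ℚ (Module.End ℚ U))
    (hbr : ∀ X ∈ 𝔞, ∀ X' ∈ 𝔞,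
      ι₁ ∘ₗ ((π₁ ∘ₗ X ∘ₗ ι₁) * (π₁ ∘ₗ X' ∘ₗ ι₁) - (π₁ ∘ₗ X' ∘ₗ ι₁) * (π₁ ∘ₗ X ∘ₗ ι₁)) ∘ₗ π₁ ∈ 𝔞)
    {Y Y' : Module.End ℂ (ℂ ⊗[ℚ] V₁)}
    (hY : Y ∈ Submodule.span ℂ ((fun X : Module.End ℚ U => (π₁ ∘ₗ X ∘ₗ ι₁).baseChange ℂ) '' (𝔞 : Set _)))
    (hY' : Y' ∈ Submodule.span ℂ ((fun X : Module.End ℚ U => (π₁ ∘ₗ X ∘ₗ ι₁).baseChange ℂ) '' (𝔞 : Set _))) :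
    ι₁.baseChange ℂ ∘ₗ (Y * Y' - Y' * Y) ∘ₗ π₁.baseChange ℂ ∈ spanC 𝔞 := by
  -- first a generator on the left
  have inner : ∀ X ∈ 𝔞, ∀ Y' ∈ Submodule.span ℂ
      ((fun X : Module.End ℚ U => (π₁ ∘ₗ X ∘ₗ ι₁).baseChange ℂ) '' (𝔞 : Set _)),
      ι₁.baseChange ℂ ∘ₗ ((π₁ ∘ₗ X ∘ₗ ι₁).baseChange ℂ * Y' - Y' * (π₁ ∘ₗ X ∘ₗ ι₁).baseChange ℂ) ∘ₗ
        π₁.baseChange ℂ ∈ spanC 𝔞 := by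
    intro X hX Y' hY'
    induction hY' using Submodule.span_induction with
    | mem Z' hZ' =>
      obtain ⟨X', hX', rfl⟩ := hZ'
      have h := baseChange_mem_spanC (hbr X hX X' hX')
      rw [LinearMap.baseChange_comp, LinearMap.baseChange_comp, LinearMap.baseChange_sub, LinearMap.baseChange_mul,
        LinearMap.baseChange_mul] at h
      exact h
    | zero => rw [mul_zero, zero_mul, sub_zero, LinearMap.zero_comp, LinearMap.comp_zero]; exact Submodule.zero_mem _
    | add Z' Z'' _ _ h' h'' =>
      have e : (π₁ ∘ₗ X ∘ₗ ι₁).baseChange ℂ * (Z' + Z'') - (Z' + Z'') * (π₁ ∘ₗ X ∘ₗ ι₁).baseChange ℂ =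
          ((π₁ ∘ₗ X ∘ₗ ι₁).baseChange ℂ * Z' - Z' * (π₁ ∘ₗ X ∘ₗ ι₁).baseChange ℂ) +
          ((π₁ ∘ₗ X ∘ₗ ι₁).baseChange ℂ * Z'' - Z'' * (π₁ ∘ₗ X ∘ₗ ι₁).baseChange ℂ) := by noncomm_ring
      rw [e, LinearMap.add_comp, LinearMap.comp_add]
      exact Submodule.add_mem _ h' h''
    | smul c Z' _ h' =>
      have e : (π₁ ∘ₗ X ∘ₗ ι₁).baseChange ℂ * (c • Z') - (c • Z') * (π₁ ∘ₗ X ∘ₗ ι₁).baseChange ℂ =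
          c • ((π₁ ∘ₗ X ∘ₗ ι₁).baseChange ℂ * Z' - Z' * (π₁ ∘ₗ X ∘ₗ ι₁).baseChange ℂ) := by
        rw [mul_smul_comm, smul_mul_assoc, smul_sub]
      rw [e, LinearMap.smul_comp, LinearMap.comp_smul]
      exact Submodule.smul_mem _ c h'
  induction hY using Submodule.span_induction with
  | mem Z hZ =>
    obtain ⟨X, hX, rfl⟩ := hZ
    exact inner X hX Y' hY'
  | zero => rw [mul_zero, zero_mul, sub_zero, LinearMap.zero_comp, LinearMap.comp_zero]; exact Submodule.zero_mem _
  | add Z Z'' _ _ h h'' =>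
    have e : (Z + Z'') * Y' - Y' * (Z + Z'') = (Z * Y' - Y' * Z) + (Z'' * Y' - Y' * Z'') := by noncomm_ring
    rw [e, LinearMap.add_comp, LinearMap.comp_add]
    exact Submodule.add_mem _ h h''
  | smul c Z _ h =>
    have e : (c • Z) * Y' - Y' * (c • Z) = c • (Z * Y' - Y' * Z) := by
      rw [mul_smul_comm, smul_mul_assoc, smul_sub]
    rw [e, LinearMap.smul_comp, LinearMap.comp_smul]
    exact Submodule.smul_mem _ c h

end Goursat

/-! ### §5 `𝔰𝔩₂` is perfect, blockwise: `assemble N` is a sum of three brackets for trace-free `N` -/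

section Perfect

variable {K : Type*} [Field K] {W : Type*} [AddCommGroup W] [Module K W]
variable {ι : Type*} [Fintype ι] [DecidableEq ι] {T : ι → Submodule K W}

/-- `assemble` is multiplicative: block-diagonal operators compose blockwise. [cite: Hazama1983, §3 (p. 306)] -/
theorem assemble_mul (hint : DirectSum.IsInternal T) (b : ∀ i, Module.Basis (Fin 2) K (T i))
    (M M' : ι → Matrix (Fin 2) (Fin 2) K) :
    assemble hint b (M * M') = assemble hint b M * assemble hint b M' := by
  have hM := assemble_mapsTo hint b M
  have hM' := assemble_mapsTo hint b M'
  have hMM' : ∀ i, Set.MapsTo (assemble hint b M * assemble hint b M') (T i) (T i) :=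
    fun i x hx => hM i (hM' i hx)
  refine eq_of_blockMat_eq hint b (assemble_mapsTo hint b _) hMM' ?_
  rw [blockMat_assemble, blockMat_mul hint b hM hM', blockMat_assemble, blockMat_assemble]

/-- **A trace-free `2 × 2` matrix is a sum of three brackets of trace-free matrices**:
`N = [h, ½ n₀₁ e] + [½ n₁₀ f, h] + [n₀₀ e, f]` with the standard triple `e = E₀₁`, `f = E₁₀`, `h = diag(1,-1)`
(`[h, e] = 2e`, `[h, f] = -2f`, `[e, f] = h`). [cite: GoodmanWallachGTM255, §2.5.3 and §4.1.1] -/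
theorem matrix_eq_sum_brackets_of_trace_eq_zero {k : Type*} [Field k] [CharZero k] (N : Matrix (Fin 2) (Fin 2) k)
    (hN : N.trace = 0) :
    N = (Matrix.diagonal ![(1 : k), -1] * ((N 0 1 / 2) • Matrix.single 0 1 (1 : k)) -
          ((N 0 1 / 2) • Matrix.single 0 1 (1 : k)) * Matrix.diagonal ![(1 : k), -1]) +
        (((N 1 0 / 2) • Matrix.single 1 0 (1 : k)) * Matrix.diagonal ![(1 : k), -1] -
          Matrix.diagonal ![(1 : k), -1] * ((N 1 0 / 2) • Matrix.single 1 0 (1 : k))) +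
        ((N 0 0 • Matrix.single 0 1 (1 : k)) * Matrix.single 1 0 (1 : k) -
          Matrix.single 1 0 (1 : k) * (N 0 0 • Matrix.single 0 1 (1 : k))) := by
  rw [Matrix.trace_fin_two] at hN
  have h11 : N 1 1 = -N 0 0 := by linear_combination hN
  ext a c
  fin_cases a <;> fin_cases c <;>
    simp [Matrix.mul_apply, Matrix.single, Matrix.diagonal, h11]

/-- **`assemble N` is a sum of three brackets of assembled trace-free families** (`𝔰𝔩₂ = [𝔰𝔩₂, 𝔰𝔩₂]`,
block by block). [cite: GoodmanWallachGTM255, §2.5.3 and §4.1.1] [cite: Hazama1983, §3 (p. 306)] -/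
theorem assemble_eq_sum_brackets {k : Type*} [Field k] [CharZero k] {W' : Type*} [AddCommGroup W'] [Module k W']
    {T' : ι → Submodule k W'} (hint : DirectSum.IsInternal T') (b : ∀ i, Module.Basis (Fin 2) k (T' i))
    (N : ι → Matrix (Fin 2) (Fin 2) k) (hN : ∀ i, (N i).trace = 0) :
    ∃ A B : Fin 3 → ι → Matrix (Fin 2) (Fin 2) k, (∀ r i, (A r i).trace = 0) ∧ (∀ r i, (B r i).trace = 0) ∧
      assemble hint b N = ∑ r, (assemble hint b (A r) * assemble hint b (B r) - assemble hint b (B r) * assemble hint b (A r)) := by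
  set e : Matrix (Fin 2) (Fin 2) k := Matrix.single 0 1 (1 : k) with he
  set f : Matrix (Fin 2) (Fin 2) k := Matrix.single 1 0 (1 : k) with hf
  set h : Matrix (Fin 2) (Fin 2) k := Matrix.diagonal ![(1 : k), -1] with hh
  have tre : e.trace = 0 := by rw [he, Matrix.trace_fin_two]; simp [Matrix.single]
  have trf : f.trace = 0 := by rw [hf, Matrix.trace_fin_two]; simp [Matrix.single]
  have trh : h.trace = 0 := by rw [hh, Matrix.trace_fin_two]; simp
  refine ⟨![fun _ => h, fun i => (N i 1 0 / 2) • f, fun i => N i 0 0 • e],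
    ![fun i => (N i 0 1 / 2) • e, fun _ => h, fun _ => f], ?_, ?_, ?_⟩
  · intro r i
    fin_cases r
    · exact trh
    · change ((N i 1 0 / 2) • f).trace = 0
      rw [Matrix.trace_smul, trf, smul_zero]
    · change (N i 0 0 • e).trace = 0
      rw [Matrix.trace_smul, tre, smul_zero]
  · intro r i
    fin_cases r
    · change ((N i 0 1 / 2) • e).trace = 0
      rw [Matrix.trace_smul, tre, smul_zero]
    · exact trh
    · exact trf
  · have hNsum : N = (fun _ => h) * (fun i => (N i 0 1 / 2) • e) - (fun i => (N i 0 1 / 2) • e) * (fun _ => h) +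
        ((fun i => (N i 1 0 / 2) • f) * (fun _ => h) - (fun _ => h) * (fun i => (N i 1 0 / 2) • f)) +
        ((fun i => N i 0 0 • e) * (fun _ => f) - (fun _ => f) * (fun i => N i 0 0 • e)) := by
      funext i
      simp only [Pi.add_apply, Pi.sub_apply, Pi.mul_apply]
      rw [he, hf, hh]
      exact matrix_eq_sum_brackets_of_trace_eq_zero (N i) (hN i)
    rw [Fin.sum_univ_three]
    simp only [Matrix.cons_val_zero, Matrix.cons_val_one, Matrix.cons_val]
    conv_lhs => rw [hNsum]
    simp only [map_add, map_sub, assemble_mul]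

end Perfect

/-! ### §6 The theorem: `⊕_i 𝔰𝔩(T_{σ_i}) ⊕ 0` kills every rational tensor killed by `Θ_U` -/

section Main

universe u

variable {U V₁ V₂ : Type u} [AddCommGroup U] [Module ℚ U] [AddCommGroup V₁] [Module ℚ V₁]
  [AddCommGroup V₂] [Module ℚ V₂] [Module.Finite ℚ U] [Module.Finite ℚ V₁] [Module.Finite ℚ V₂]
  [HodgeTensorFacts.{u, u}] {n : ℤ}
variable {M d m : ℕ}

/-- **Theorem (Lombardo 2016 Lemma 3.4 / Moonen–Zarhin 1999 (3.1), Lie step, in the word model).** Let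
`U = ι₁V₁ ⊕ ι₂V₂` be a presentation compatible with Hodge structures `H_U`, `H₁`, `H₂` of the same odd weight
(`ι₁`, `ι₂` map `V_i^{p,n-p}` into `U^{p,n-p}`). On `V₁` let `ψ₁` be a polarization with `End_Hdg(V₁)`
self-adjoint and `σ` real characters of `End_Hdg(V₁)` whose two-dimensional eigenblocks decompose `V₁ ⊗ ℂ`
(real `𝔰𝔩₂`-block data), with block bases `b`; on `V₂` let `aF₂` be Hodge endomorphisms whose commutant in
`End_ℚ(V₂)` is commutative (CM). If a RATIONAL coefficient tensor `q` on `U` (letters: `Fin m` slots × the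
`ℚ`-basis `eQ`) is killed, slice by slice, by the matrix of the Hodge operator `Θ_U`, then it is killed by
the matrix of `ι₁ ∘ Z ∘ π₁` for every block-diagonal `Z = assemble b N` with trace-free blocks `N`:
`(⊕_i 𝔰𝔩(T_{σ_i})) ⊕ 0 ⊆ 𝔞(q)_ℂ`. («`H(A × B) ≅ H(A) × H(B)`» for `B` of CM type and `A` without factors of
type IV, here for `A` with real `𝔰𝔩₂`-blocks; the tree has no algebraic groups, and this is the statement
used on tensors.) [cite: Lombardo2016, Lemma 3.4 (p. 1229)] [cite: MoonenZarhin1999LowDim, §3 (3.1)]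
[cite: Deligne1982HodgeCycles, I §3 (proof of Prop. 3.4)] -/
theorem wordDerAt_assemble_eq_zero_of_semisimple_times_abelian (hn : Odd n) (HU : HodgeStructure U n)
    (H₁ : HodgeStructure V₁ n) (H₂ : HodgeStructure V₂ n)
    {ι₁ : V₁ →ₗ[ℚ] U} {π₁ : U →ₗ[ℚ] V₁} {ι₂ : V₂ →ₗ[ℚ] U} {π₂ : U →ₗ[ℚ] V₂}
    (hπι₁ : π₁ ∘ₗ ι₁ = LinearMap.id) (hπι₂ : π₂ ∘ₗ ι₂ = LinearMap.id) (hπ₁ι₂ : π₁ ∘ₗ ι₂ = 0)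
    (hπ₂ι₁ : π₂ ∘ₗ ι₁ = 0) (hsum : ι₁ ∘ₗ π₁ + ι₂ ∘ₗ π₂ = LinearMap.id)
    (hι₁F : ∀ p, ∀ x ∈ H₁.piece p (n - p), ι₁.baseChange ℂ x ∈ HU.piece p (n - p))
    (hι₂F : ∀ p, ∀ x ∈ H₂.piece p (n - p), ι₂.baseChange ℂ x ∈ HU.piece p (n - p))
    {ι : Type*} [Fintype ι] [DecidableEq ι] (ψ₁ : H₁.Polarization)
    (hself₁ : ∀ a : H₁.endAlg,
      LinearMap.IsAdjointPair ψ₁.form ψ₁.form (a : Module.End ℚ V₁) (a : Module.End ℚ V₁))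
    (σ : ι → (H₁.endAlg →+* ℂ)) (hreal : ∀ i, (starRingEnd ℂ).comp (σ i) = σ i)
    (hint : DirectSum.IsInternal fun i => H₁.eigenBlock (σ i))
    (h2 : ∀ i, Module.finrank ℂ (H₁.eigenBlock (σ i)) = 2)
    (b : ∀ i, Module.Basis (Fin 2) ℂ (H₁.eigenBlock (σ i)))
    {ιF : Type*} (aF₂ : ιF → H₂.endAlg)
    (hF₂ : ∀ Y Y' : Module.End ℚ V₂, (∀ f, Y * (aF₂ f : Module.End ℚ V₂) = (aF₂ f : Module.End ℚ V₂) * Y) →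
      (∀ f, Y' * (aF₂ f : Module.End ℚ V₂) = (aF₂ f : Module.End ℚ V₂) * Y') → Y * Y' = Y' * Y)
    (eQ : Module.Basis (Fin M) ℚ U) (q : (Fin d → Fin m × Fin M) → ℚ)
    {ΘU : Module.End ℂ (ℂ ⊗[ℚ] U)} (hΘU : ∀ p, ∀ x ∈ HU.piece p (n - p), ΘU x = ((2 * p - n : ℤ) : ℂ) • x)
    (hΘq : ∀ u : Fin d → Fin m, wordDerAt ℂ (fun _ : Fin d =>
      LinearMap.toMatrix (Algebra.TensorProduct.basis ℂ eQ) (Algebra.TensorProduct.basis ℂ eQ) ΘU)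
      (wordSlice (fun w => algebraMap ℚ ℂ (q w)) u) = 0)
    (N : ι → Matrix (Fin 2) (Fin 2) ℂ) (hN : ∀ i, (N i).trace = 0) (u : Fin d → Fin m) :
    wordDerAt ℂ (fun _ : Fin d =>
      LinearMap.toMatrix (Algebra.TensorProduct.basis ℂ eQ) (Algebra.TensorProduct.basis ℂ eQ)
        (ι₁.baseChange ℂ ∘ₗ assemble hint b N ∘ₗ π₁.baseChange ℂ))
      (wordSlice (fun w => algebraMap ℚ ℂ (q w)) u) = 0 := by
  classical
  obtain ⟨Θ₁, hΘ₁⟩ := exists_hodgeTheta H₁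
  obtain ⟨Θ₂, hΘ₂⟩ := exists_hodgeTheta H₂
  have hΘ₁C : Θ₁ ∈ H₁.hodgeLieC := H₁.mem_hodgeLieC_of_forall_piece hΘ₁
  have hΘ₂C : Θ₂ ∈ H₂.hodgeLieC := H₂.mem_hodgeLieC_of_forall_piece hΘ₂
  have hsum' : ι₂ ∘ₗ π₂ + ι₁ ∘ₗ π₁ = LinearMap.id := by rw [add_comm]; exact hsum
  -- pointwise slot identities
  have e11 : ∀ v, π₁ (ι₁ v) = v := fun v => by
    rw [← LinearMap.comp_apply (f := π₁), hπι₁, LinearMap.id_apply]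
  have e22 : ∀ w, π₂ (ι₂ w) = w := fun w => by
    rw [← LinearMap.comp_apply (f := π₂), hπι₂, LinearMap.id_apply]
  -- `Θ` through the presentation
  have hΘι₁ := theta_incl_eq HU H₁ hι₁F hΘU hΘ₁
  have hΘι₂ := theta_incl_eq HU H₂ hι₂F hΘU hΘ₂
  have hΘπ₁ := proj_theta_eq HU H₁ H₂ hπι₁ hπ₁ι₂ hsum hι₁F hι₂F hΘU hΘ₁ hΘ₂
  have hΘπ₂ := proj_theta_eq HU H₂ H₁ hπι₂ hπ₂ι₁ hsum' hι₂F hι₁F hΘU hΘ₂ hΘ₁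
  -- the commuting family: `ι₁ a π₁` (`a ∈ End_Hdg V₁`), `ι₂ f π₂` (`f ∈ aF₂`), the two projectors
  set aF : (H₁.endAlg ⊕ ιF) ⊕ (Unit ⊕ Unit) → Module.End ℚ U :=
    Sum.elim (Sum.elim (fun a => ι₁ ∘ₗ (a : Module.End ℚ V₁) ∘ₗ π₁)
      (fun f => ι₂ ∘ₗ (aF₂ f : Module.End ℚ V₂) ∘ₗ π₂))
      (Sum.elim (fun _ => ι₁ ∘ₗ π₁) (fun _ => ι₂ ∘ₗ π₂)) with haF
  set φ : LinearMap.BilinForm ℚ U := ψ₁.form.compl₁₂ π₁ π₁ with hφ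
  set 𝔞 : Submodule ℚ (Module.End ℚ U) := annLie φ eQ aF q with h𝔞
  -- `Θ_U ∈ 𝔞_ℂ`
  have hΘ𝔞 : ΘU ∈ spanC 𝔞 := by
    refine mem_spanC_annLie φ eQ aF q hΘq (fun i => ?_) (fun x y => ?_)
    · apply LinearMap.ext
      intro y
      rcases i with (a | f) | (_ | _)
      · change ΘU ((ι₁ ∘ₗ (a : Module.End ℚ V₁) ∘ₗ π₁).baseChange ℂ y) =
          (ι₁ ∘ₗ (a : Module.End ℚ V₁) ∘ₗ π₁).baseChange ℂ (ΘU y)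
        simp only [LinearMap.baseChange_comp, LinearMap.comp_apply]
        rw [hΘι₁, ← Module.End.mul_apply (f := Θ₁), commute_baseChange_of_mem_hodgeLieC H₁ hΘ₁C a,
          Module.End.mul_apply, hΘπ₁]
      · change ΘU ((ι₂ ∘ₗ (aF₂ f : Module.End ℚ V₂) ∘ₗ π₂).baseChange ℂ y) =
          (ι₂ ∘ₗ (aF₂ f : Module.End ℚ V₂) ∘ₗ π₂).baseChange ℂ (ΘU y)
        simp only [LinearMap.baseChange_comp, LinearMap.comp_apply]
        rw [hΘι₂, ← Module.End.mul_apply (f := Θ₂), commute_baseChange_of_mem_hodgeLieC H₂ hΘ₂C (aF₂ f),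
          Module.End.mul_apply, hΘπ₂]
      · change ΘU ((ι₁ ∘ₗ π₁).baseChange ℂ y) = (ι₁ ∘ₗ π₁).baseChange ℂ (ΘU y)
        simp only [LinearMap.baseChange_comp, LinearMap.comp_apply]
        rw [hΘι₁, hΘπ₁]
      · change ΘU ((ι₂ ∘ₗ π₂).baseChange ℂ y) = (ι₂ ∘ₗ π₂).baseChange ℂ (ΘU y)
        simp only [LinearMap.baseChange_comp, LinearMap.comp_apply]
        rw [hΘι₂, hΘπ₂]
    · rw [hφ, baseChange_compl₁₂_apply, baseChange_compl₁₂_apply, hΘπ₁, hΘπ₁,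
        formBaseChange_skew_of_mem_hodgeLieC ψ₁ hΘ₁C, neg_add_cancel]
  -- what membership in `𝔞` gives
  have hmem : ∀ X ∈ 𝔞, (∀ i, X * aF i = aF i * X) ∧ ∀ v w, φ (X v) w + φ v (X w) = 0 :=
    fun X hX => ((mem_annLie_iff φ eQ aF q X).1 hX).2
  have hP₁ : ∀ X ∈ 𝔞, X * (ι₁ ∘ₗ π₁) = (ι₁ ∘ₗ π₁) * X := fun X hX => (hmem X hX).1 (Sum.inr (Sum.inl ()))
  have hP₂ : ∀ X ∈ 𝔞, X * (ι₂ ∘ₗ π₂) = (ι₂ ∘ₗ π₂) * X := fun X hX => (hmem X hX).1 (Sum.inr (Sum.inr ()))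
  have hTa : ∀ X ∈ 𝔞, ∀ a : H₁.endAlg, X * (ι₁ ∘ₗ (a : Module.End ℚ V₁) ∘ₗ π₁) =
      (ι₁ ∘ₗ (a : Module.End ℚ V₁) ∘ₗ π₁) * X := fun X hX a => (hmem X hX).1 (Sum.inl (Sum.inl a))
  have hTf : ∀ X ∈ 𝔞, ∀ f, X * (ι₂ ∘ₗ (aF₂ f : Module.End ℚ V₂) ∘ₗ π₂) =
      (ι₂ ∘ₗ (aF₂ f : Module.End ℚ V₂) ∘ₗ π₂) * X := fun X hX f => (hmem X hX).1 (Sum.inl (Sum.inr f))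
  -- the corners commute with `End_Hdg(V₁)` resp. `aF₂`
  have hc₁comm : ∀ X ∈ 𝔞, ∀ a : H₁.endAlg, (π₁ ∘ₗ X ∘ₗ ι₁) * (a : Module.End ℚ V₁) =
      (a : Module.End ℚ V₁) * (π₁ ∘ₗ X ∘ₗ ι₁) := by
    intro X hX a
    apply LinearMap.ext
    intro v
    have h := congrArg (fun f : Module.End ℚ U => π₁ (f (ι₁ v))) (hTa X hX a)
    simp only [Module.End.mul_apply, LinearMap.comp_apply, e11] at h
    simp only [Module.End.mul_apply, LinearMap.comp_apply]
    exact h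
  have hc₂comm : ∀ X ∈ 𝔞, ∀ f, (π₂ ∘ₗ X ∘ₗ ι₂) * (aF₂ f : Module.End ℚ V₂) =
      (aF₂ f : Module.End ℚ V₂) * (π₂ ∘ₗ X ∘ₗ ι₂) := by
    intro X hX f
    apply LinearMap.ext
    intro w
    have h := congrArg (fun g : Module.End ℚ U => π₂ (g (ι₂ w))) (hTf X hX f)
    simp only [Module.End.mul_apply, LinearMap.comp_apply, e22] at h
    simp only [Module.End.mul_apply, LinearMap.comp_apply]
    exact h
  have hc₁skew : ∀ X ∈ 𝔞, ∀ v w, ψ₁.form ((π₁ ∘ₗ X ∘ₗ ι₁) v) w + ψ₁.form v ((π₁ ∘ₗ X ∘ₗ ι₁) w) = 0 := by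
    intro X hX v w
    have h := (hmem X hX).2 (ι₁ v) (ι₁ w)
    rw [hφ, LinearMap.compl₁₂_apply, LinearMap.compl₁₂_apply, e11, e11] at h
    simpa only [LinearMap.comp_apply] using h
  -- the Goursat step inside `𝔞`
  have hbr𝔞 : ∀ X ∈ 𝔞, ∀ X' ∈ 𝔞,
      ι₁ ∘ₗ ((π₁ ∘ₗ X ∘ₗ ι₁) * (π₁ ∘ₗ X' ∘ₗ ι₁) - (π₁ ∘ₗ X' ∘ₗ ι₁) * (π₁ ∘ₗ X ∘ₗ ι₁)) ∘ₗ π₁ ∈ 𝔞 := by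
    intro X hX X' hX'
    rw [← bracket_eq_incl_corner_bracket_proj hπι₁ hπι₂ hsum (hP₁ X hX) (hP₂ X hX) (hP₁ X' hX') (hP₂ X' hX')
      (hF₂ _ _ (hc₂comm X hX) (hc₂comm X' hX'))]
    exact commutator_mem_annLie φ eQ aF q hX hX'
  -- the corner algebra `𝔤 = c₁(𝔞) ⊆ 𝔰𝔭_E(V₁, ψ₁)`
  obtain ⟨cLin, hcLin⟩ : ∃ L : Module.End ℚ U →ₗ[ℚ] Module.End ℚ V₁, ∀ X, L X = π₁ ∘ₗ X ∘ₗ ι₁ :=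
    ⟨{ toFun := fun X => π₁ ∘ₗ X ∘ₗ ι₁
       map_add' := fun X X' => by rw [LinearMap.add_comp, LinearMap.comp_add]
       map_smul' := fun c X => by rw [LinearMap.smul_comp, LinearMap.comp_smul, RingHom.id_apply] },
      fun X => rfl⟩
  set 𝔤 : Submodule ℚ (Module.End ℚ V₁) := 𝔞.map cLin with h𝔤
  have h𝔤mem : ∀ {Y}, Y ∈ 𝔤 ↔ ∃ X ∈ 𝔞, π₁ ∘ₗ X ∘ₗ ι₁ = Y := by
    intro Y
    rw [h𝔤, Submodule.mem_map]
    simp only [hcLin]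
  have hbr𝔤 : ∀ Y ∈ 𝔤, ∀ Y' ∈ 𝔤, Y * Y' - Y' * Y ∈ 𝔤 := by
    intro Y hY Y' hY'
    obtain ⟨X, hX, rfl⟩ := h𝔤mem.1 hY
    obtain ⟨X', hX', rfl⟩ := h𝔤mem.1 hY'
    refine h𝔤mem.2 ⟨_, hbr𝔞 X hX X' hX', ?_⟩
    apply LinearMap.ext
    intro v
    simp only [LinearMap.comp_apply, LinearMap.sub_apply, Module.End.mul_apply, e11]
  have hcomm𝔤 : ∀ Y ∈ 𝔤, ∀ a : H₁.endAlg, Y * (a : Module.End ℚ V₁) = (a : Module.End ℚ V₁) * Y := by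
    intro Y hY a
    obtain ⟨X, hX, rfl⟩ := h𝔤mem.1 hY
    exact hc₁comm X hX a
  have hskew𝔤 : ∀ Y ∈ 𝔤, ∀ v w, ψ₁.form (Y v) w + ψ₁.form v (Y w) = 0 := by
    intro Y hY v w
    obtain ⟨X, hX, rfl⟩ := h𝔤mem.1 hY
    exact hc₁skew X hX v w
  have hspanC𝔤 : spanC 𝔤 = Submodule.span ℂ
      ((fun X : Module.End ℚ U => (π₁ ∘ₗ X ∘ₗ ι₁).baseChange ℂ) '' (𝔞 : Set _)) := by
    rw [spanC, h𝔤, Submodule.map_coe, Set.image_image]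
    simp only [hcLin]
  -- `Θ₁ = c₁(Θ_U) ∈ 𝔤_ℂ`
  have hcorner : ∀ T ∈ spanC 𝔞, π₁.baseChange ℂ ∘ₗ T ∘ₗ ι₁.baseChange ℂ ∈ spanC 𝔤 := by
    intro T hT
    induction hT using Submodule.span_induction with
    | mem Z hZ =>
      obtain ⟨X, hX, rfl⟩ := hZ
      rw [← LinearMap.baseChange_comp, ← LinearMap.baseChange_comp]
      exact baseChange_mem_spanC (h𝔤mem.2 ⟨X, hX, rfl⟩)
    | zero => rw [LinearMap.zero_comp, LinearMap.comp_zero]; exact Submodule.zero_mem _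
    | add Z Z' _ _ hZ hZ' => rw [LinearMap.add_comp, LinearMap.comp_add]; exact Submodule.add_mem _ hZ hZ'
    | smul c Z _ hZ => rw [LinearMap.smul_comp, LinearMap.comp_smul]; exact Submodule.smul_mem _ c hZ
  have hΘ₁𝔤 : Θ₁ ∈ spanC 𝔤 := by
    have h : Θ₁ = π₁.baseChange ℂ ∘ₗ ΘU ∘ₗ ι₁.baseChange ℂ := by
      apply LinearMap.ext
      intro x
      rw [LinearMap.comp_apply, LinearMap.comp_apply, hΘι₁, proj_incl_baseChange hπι₁]
    rw [h]
    exact hcorner ΘU hΘ𝔞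
  -- the `Θ`-subalgebra theorem on `V₁`: `𝔤_ℂ ⊇ ⊕ 𝔰𝔩(T_σ)`
  have hZ : ∀ N' : ι → Matrix (Fin 2) (Fin 2) ℂ, (∀ i, (N' i).trace = 0) → assemble hint b N' ∈ spanC 𝔤 :=
    fun N' hN' => (ThetaSubalgebra.mem_spanC_iff_mapsTo_and_skew H₁ hn ψ₁ hself₁ σ hreal hint h2 𝔤 hbr𝔤 hΘ₁ hΘ₁𝔤
      hcomm𝔤 hskew𝔤 _).2 ⟨assemble_mapsTo hint b N', formBaseChange_assemble_add_eq_zero H₁ hn ψ₁ hself₁ σ hint b N' hN'⟩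
  -- brackets of elements of `𝔤_ℂ`, placed on `V₁`, lie in `𝔞_ℂ`
  have hD : ∀ Y ∈ spanC 𝔤, ∀ Y' ∈ spanC 𝔤,
      ι₁.baseChange ℂ ∘ₗ (Y * Y' - Y' * Y) ∘ₗ π₁.baseChange ℂ ∈ spanC 𝔞 := by
    intro Y hY Y' hY'
    rw [hspanC𝔤] at hY hY'
    exact incl_bracket_proj_mem_spanC 𝔞 hbr𝔞 hY hY'
  -- `𝔰𝔩₂` is perfect
  obtain ⟨A, B, hA, hB, hNsum⟩ := assemble_eq_sum_brackets hint b N hN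
  have hmemN : ι₁.baseChange ℂ ∘ₗ assemble hint b N ∘ₗ π₁.baseChange ℂ ∈ spanC 𝔞 := by
    have hs : ι₁.baseChange ℂ ∘ₗ (∑ r, (assemble hint b (A r) * assemble hint b (B r) -
        assemble hint b (B r) * assemble hint b (A r))) ∘ₗ π₁.baseChange ℂ =
        ∑ r, ι₁.baseChange ℂ ∘ₗ (assemble hint b (A r) * assemble hint b (B r) -
          assemble hint b (B r) * assemble hint b (A r)) ∘ₗ π₁.baseChange ℂ := by
      apply LinearMap.ext
      intro y
      simp only [LinearMap.comp_apply, LinearMap.sum_apply, map_sum]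
    rw [hNsum, hs]
    exact Submodule.sum_mem _ fun r _ => hD _ (hZ _ (hA r)) _ (hZ _ (hB r))
  exact wordDerAt_eq_zero_of_mem_spanC_annLie φ eQ aF q hmemN u

end Main



end HodgeStructure

end Literature.AlgebraicGeometry.Motives

end
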